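import Mathlib
import Literature.NumberTheory.LFunctions.LiouvilleSumClassicalBound
import Literature.Computability.MetaComplexity.SmolenskyRows

/-!
# The mean of `λ` over the `n`-bit numbers is `o(2ⁿ)`

Wave-2 support of line Sketch/LAR (inverse direction and LAR at level 1) of crux
stmt-QuantumAdvantage-1392 (`DigitPolyUniformity`, route `MobiusLadder`): the prime number theorem
for the Liouville function, in cube form. Numbering the Boolean cube `{0,1}ⁿ` by
`val b = boolFunEquivFin n b ∈ [0, 2ⁿ)`,

  `|Σ_{b ∈ {0,1}ⁿ} λ(val b)| ≤ ε · 2ⁿ`  eventually in `n`, for every `ε > 0`.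

Proof: reindex to `Σ_{N < 2ⁿ} λ(N) = Σ_{0 < N ≤ 2ⁿ} λ(N) − λ(2ⁿ)` (`λ(0) = 0`), bound the first sum
by the tree's PNT for `λ` (`Literature.NumberTheory.LFunctions.abs_sum_liouville_le_logPow` with
`A = 1` at `x = 2ⁿ`: `≤ C·2ⁿ/(n log 2)`) and the last term by `1`; both are eventually `≤ (ε/2)·2ⁿ`.
-/

namespace Summit.QuantumAdvantage.DigitPolyUniformity.SketchLAR

open Filter Finset Module
open Literature.Computability.MetaComplexity (boolFunEquivFin)

namespace LiouvilleCubeMean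

/-- **Reindexing the cube.** `Σ_{b ∈ {0,1}ⁿ} λ(val b) = Σ_{N < 2ⁿ} λ(N)`: `val = boolFunEquivFin n`
is a bijection `{0,1}ⁿ ≃ [0, 2ⁿ)`. [folklore] -/
theorem sum_cube_eq_sum_range (n : ℕ) :
    ∑ b : Fin n → Bool,
        ((ArithmeticFunction.liouville ((boolFunEquivFin n b : Fin (2 ^ n)) : ℕ) : ℤ) : ℝ) =
      ∑ N ∈ range (2 ^ n), ((ArithmeticFunction.liouville N : ℤ) : ℝ) := by
  rw [← Fin.sum_univ_eq_sum_range]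
  exact Equiv.sum_comp (boolFunEquivFin n)
    (fun k : Fin (2 ^ n) => ((ArithmeticFunction.liouville (k : ℕ) : ℤ) : ℝ))

/-- **From `[0, M)` to `(0, M]`.** `Σ_{N < M} λ(N) = Σ_{0 < N ≤ M} λ(N) − λ(M)`, since `λ(0) = 0`.
[folklore] -/
theorem sum_range_eq_sum_Ioc_sub (M : ℕ) :
    ∑ N ∈ range M, ((ArithmeticFunction.liouville N : ℤ) : ℝ) =
      ∑ N ∈ Ioc 0 M, ((ArithmeticFunction.liouville N : ℤ) : ℝ) -
        ((ArithmeticFunction.liouville M : ℤ) : ℝ) := by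
  induction M with
  | zero => simp
  | succ M ih =>
    rw [Finset.sum_range_succ, Finset.sum_Ioc_succ_top (Nat.zero_le M), ih]
    ring

end LiouvilleCubeMean

/-- **The mean of `λ` over the `n`-bit numbers is `o(2ⁿ)`** (PNT for `λ`, cube form): for every
`ε > 0`, eventually in `n`, `|Σ_{b ∈ {0,1}ⁿ} λ(val b)| ≤ ε·2ⁿ` where `val b = boolFunEquivFin n b`.
Reindex to `Σ_{N < 2ⁿ} λ(N) = Σ_{0 < N ≤ 2ⁿ} λ(N) − λ(2ⁿ)`, bound the sum by the tree's
`Literature.NumberTheory.LFunctions.abs_sum_liouville_le_logPow 1` at `x = 2ⁿ`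
(`≤ C·2ⁿ/(n log 2)`) and `|λ(2ⁿ)| ≤ 1`.
[folklore] -/
theorem stub_liouville_cube_mean :
    ∀ ε : ℝ, 0 < ε → ∀ᶠ n : ℕ in atTop,
      |∑ b : Fin n → Bool,
          ((ArithmeticFunction.liouville ((boolFunEquivFin n b : Fin (2 ^ n)) : ℕ) : ℤ) : ℝ)| ≤
        ε * 2 ^ n := by
  intro ε hε
  obtain ⟨C, hC⟩ := Literature.NumberTheory.LFunctions.abs_sum_liouville_le_logPow 1
  -- eventually `C⁺/(n log 2) ≤ ε/2` and `1 ≤ (ε/2)·2ⁿ`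
  have h1 : ∀ᶠ n : ℕ in atTop, max C 0 / Real.log 2 / (n : ℝ) ≤ ε / 2 :=
    (tendsto_const_div_atTop_nhds_zero_nat (max C 0 / Real.log 2)).eventually_le_const
      (half_pos hε)
  have h2 : ∀ᶠ n : ℕ in atTop, 1 ≤ ε / 2 * (2 : ℝ) ^ n :=
    ((tendsto_pow_atTop_atTop_of_one_lt one_lt_two).const_mul_atTop (half_pos hε)
      ).eventually_ge_atTop 1
  filter_upwards [h1, h2, eventually_ge_atTop 1] with n hn1 hn2 hn
  rw [LiouvilleCubeMean.sum_cube_eq_sum_range, LiouvilleCubeMean.sum_range_eq_sum_Ioc_sub]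
  -- PNT for `λ` at `x = 2ⁿ`
  have hx : (2 : ℝ) ≤ (2 : ℝ) ^ n :=
    calc (2 : ℝ) = 2 ^ 1 := (pow_one _).symm
      _ ≤ 2 ^ n := pow_le_pow_right₀ one_le_two hn
  have hCn := hC ((2 : ℝ) ^ n) hx
  have hfloor : ⌊(2 : ℝ) ^ n⌋₊ = 2 ^ n := by
    rw [show (2 : ℝ) ^ n = ((2 ^ n : ℕ) : ℝ) by norm_cast, Nat.floor_natCast]
  rw [hfloor, Real.rpow_one, Real.log_pow] at hCn
  have hl : |((ArithmeticFunction.liouville (2 ^ n) : ℤ) : ℝ)| ≤ 1 :=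
    Literature.NumberTheory.LFunctions.LiouvilleSum.abs_liouville_le_one _
  have hpos : (0 : ℝ) < 2 ^ n := by positivity
  calc |∑ N ∈ Ioc 0 (2 ^ n), ((ArithmeticFunction.liouville N : ℤ) : ℝ) -
          ((ArithmeticFunction.liouville (2 ^ n) : ℤ) : ℝ)|
      ≤ |∑ N ∈ Ioc 0 (2 ^ n), ((ArithmeticFunction.liouville N : ℤ) : ℝ)| +
          |((ArithmeticFunction.liouville (2 ^ n) : ℤ) : ℝ)| := abs_sub _ _
    _ ≤ C * 2 ^ n / (n * Real.log 2) + 1 := add_le_add hCn hl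
    _ ≤ max C 0 * 2 ^ n / (n * Real.log 2) + 1 := by
        gcongr
        exact le_max_left _ _
    _ = max C 0 / Real.log 2 / n * 2 ^ n + 1 := by
        rw [div_div, div_mul_eq_mul_div, mul_comm (Real.log 2)]
    _ ≤ ε / 2 * 2 ^ n + ε / 2 * 2 ^ n :=
        add_le_add (mul_le_mul_of_nonneg_right hn1 hpos.le) hn2
    _ = ε * 2 ^ n := by ring

end Summit.QuantumAdvantage.DigitPolyUniformity.SketchLAR
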